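import Mathlib

/-!
# The Grushin / Schur-complement step of (Q)(β): algebra and norm bounds

Solo-blind kernel #96 (paper §24.48 (G4)).  If the Grushin operator `𝒢 = [[P, R₋], [R₊, 0]]` is
invertible with inverse `[[E, E₊], [E₋, E₋₊]]`, the block relations give: `P` is invertible as soon as
`E₋₊` is, with `P⁻¹ = E - E₊ E₋₊⁻¹ E₋` (Schur complement).  We record (i) this identity for elements
of a ring (the operator version is the same computation entrywise), (ii) the Neumann-series bound
`‖(D + F)⁻¹‖ ≤ 2 ‖D⁻¹‖` for a dominant perturbation `‖D⁻¹ F‖ ≤ 1/2` in a complete normed ring — the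
shape of `E₋₊(z) = diag((z - s_n) p_n) + F` between two rungs — and (iii) the resulting resolvent
bound `‖E - E₊ X E₋‖ ≤ A + A² ‖X‖ ≤ A + 2 A² ‖D⁻¹‖`, polynomial in the Grushin norm `A`.
-/

namespace Summit.AnomalousDissipation.AnomalousDissipation.Theorems

section Algebra

variable {R : Type*} [Ring R]

/-- SCHUR COMPLEMENT, left inverse: from the first block column of `𝒢⁻¹ 𝒢 = 1`
(`E P + E₊ R₊ = 1`, `E₋ P + E₋₊ R₊ = 0`) and invertibility of `E₋₊`,
`(E - E₊ E₋₊⁻¹ E₋) P = 1`. -/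
theorem grushin_left_inverse (P Rp E Ep Em : R) (Empm : Rˣ)
    (h1 : E * P + Ep * Rp = 1) (h2 : Em * P + (Empm : R) * Rp = 0) :
    (E - Ep * (↑Empm⁻¹ : R) * Em) * P = 1 := by
  have hRp : Rp = -((↑Empm⁻¹ : R) * (Em * P)) := by
    have : (↑Empm⁻¹ : R) * (Em * P + (Empm : R) * Rp) = 0 := by rw [h2, mul_zero]
    rw [mul_add, Units.inv_mul_cancel_left] at this
    exact eq_neg_of_add_eq_zero_right this
  rw [hRp] at h1
  have : (E - Ep * (↑Empm⁻¹ : R) * Em) * P = E * P + Ep * -((↑Empm⁻¹ : R) * (Em * P)) := by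
    rw [sub_mul]; simp only [mul_neg, mul_assoc, sub_eq_add_neg]
  rw [this, h1]

/-- SCHUR COMPLEMENT, right inverse: from the first block row of `𝒢 𝒢⁻¹ = 1`
(`P E + R₋ E₋ = 1`, `P E₊ + R₋ E₋₊ = 0`) and invertibility of `E₋₊`,
`P (E - E₊ E₋₊⁻¹ E₋) = 1`. -/
theorem grushin_right_inverse (P Rm E Ep Em : R) (Empm : Rˣ)
    (h1 : P * E + Rm * Em = 1) (h2 : P * Ep + Rm * (Empm : R) = 0) :
    P * (E - Ep * (↑Empm⁻¹ : R) * Em) = 1 := by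
  have hPEp : P * Ep = -(Rm * (Empm : R)) := eq_neg_of_add_eq_zero_left h2
  have : P * (E - Ep * (↑Empm⁻¹ : R) * Em) = P * E - P * Ep * (↑Empm⁻¹ : R) * Em := by
    simp only [mul_sub, mul_assoc]
  rw [this, hPEp, neg_mul, Units.mul_inv_cancel_right, neg_mul, sub_neg_eq_add, h1]

/-- Hence `P` is a unit with inverse the Schur complement `E - E₊ E₋₊⁻¹ E₋`. -/
theorem grushin_isUnit (P Rm Rp E Ep Em : R) (Empm : Rˣ)
    (hl1 : E * P + Ep * Rp = 1) (hl2 : Em * P + (Empm : R) * Rp = 0)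
    (hr1 : P * E + Rm * Em = 1) (hr2 : P * Ep + Rm * (Empm : R) = 0) :
    ∃ u : Rˣ, (u : R) = P ∧ (↑u⁻¹ : R) = E - Ep * (↑Empm⁻¹ : R) * Em := by
  refine ⟨⟨P, E - Ep * (↑Empm⁻¹ : R) * Em, ?_, ?_⟩, rfl, rfl⟩
  · exact grushin_right_inverse P Rm E Ep Em Empm hr1 hr2
  · exact grushin_left_inverse P Rp E Ep Em Empm hl1 hl2

end Algebra

section Norms

variable {R : Type*} [NormedRing R] [CompleteSpace R] [NormOneClass R]

/-- Neumann series: `‖(1 - t)⁻¹‖ ≤ (1 - ‖t‖)⁻¹` for `‖t‖ < 1`. -/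
theorem norm_inv_oneSub_le (t : R) (h : ‖t‖ < 1) :
    ‖(↑(Units.oneSub t h)⁻¹ : R)‖ ≤ (1 - ‖t‖)⁻¹ := by
  have := tsum_geometric_le_of_norm_lt_one t h
  rw [norm_one, sub_self, zero_add] at this
  exact this

/-- DOMINANT PERTURBATION: if `D` is a unit and `‖D⁻¹ F‖ ≤ 1/2` then `D + F` is a unit with
`‖(D + F)⁻¹‖ ≤ 2 ‖D⁻¹‖`. -/
theorem dominant_perturbation (D : Rˣ) (F : R) (hF : ‖(↑D⁻¹ : R) * F‖ ≤ 1 / 2) :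
    ∃ u : Rˣ, (u : R) = D + F ∧ ‖(↑u⁻¹ : R)‖ ≤ 2 * ‖(↑D⁻¹ : R)‖ := by
  set t : R := -((↑D⁻¹ : R) * F) with ht
  have hnt : ‖t‖ ≤ 1 / 2 := by rw [ht, norm_neg]; exact hF
  have hlt : ‖t‖ < 1 := by linarith
  refine ⟨D * Units.oneSub t hlt, ?_, ?_⟩
  · rw [Units.val_mul, Units.val_oneSub, ht, sub_neg_eq_add, mul_add, mul_one, ← mul_assoc,
      Units.mul_inv, one_mul]
  · rw [mul_inv_rev, Units.val_mul]
    refine (norm_mul_le _ _).trans ?_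
    have h1 : ‖(↑(Units.oneSub t hlt)⁻¹ : R)‖ ≤ 2 := by
      refine (norm_inv_oneSub_le t hlt).trans ?_
      rw [inv_le_comm₀ (by linarith) (by norm_num : (0:ℝ) < 2)]
      linarith
    calc ‖(↑(Units.oneSub t hlt)⁻¹ : R)‖ * ‖(↑D⁻¹ : R)‖ ≤ 2 * ‖(↑D⁻¹ : R)‖ :=
          mul_le_mul_of_nonneg_right h1 (norm_nonneg _)

omit [CompleteSpace R] [NormOneClass R] in
/-- RESOLVENT BOUND FROM THE GRUSHIN NORM: `‖E - E₊ X E₋‖ ≤ A + A² ‖X‖` when `‖E‖, ‖E₊‖, ‖E₋‖ ≤ A`. -/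
theorem norm_schur_le (E Ep Em X : R) (A : ℝ) (hA : 0 ≤ A)
    (hE : ‖E‖ ≤ A) (hEp : ‖Ep‖ ≤ A) (hEm : ‖Em‖ ≤ A) :
    ‖E - Ep * X * Em‖ ≤ A + A ^ 2 * ‖X‖ := by
  refine (norm_sub_le _ _).trans (add_le_add hE ?_)
  calc ‖Ep * X * Em‖ ≤ ‖Ep‖ * ‖X‖ * ‖Em‖ := by
          refine (norm_mul_le _ _).trans ?_
          exact mul_le_mul_of_nonneg_right (norm_mul_le _ _) (norm_nonneg _)
    _ ≤ A * ‖X‖ * A := by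
          have := mul_le_mul hEp (le_refl ‖X‖) (norm_nonneg _) hA
          exact mul_le_mul this hEm (norm_nonneg _) (mul_nonneg hA (norm_nonneg _))
    _ = A ^ 2 * ‖X‖ := by ring

/-- THE (G4) STEP ASSEMBLED: Grushin inverse of norm `≤ A`, `E₋₊ = D + F` with `‖D⁻¹ F‖ ≤ 1/2`
(diagonal dominance between two rungs) ⇒ `P` is invertible and `‖P⁻¹‖ ≤ A + 2 A² ‖D⁻¹‖`. -/
theorem grushin_resolvent_bound (P Rm Rp E Ep Em F : R) (D : Rˣ) (A : ℝ) (hA : 0 ≤ A)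
    (hE : ‖E‖ ≤ A) (hEp : ‖Ep‖ ≤ A) (hEm : ‖Em‖ ≤ A) (hF : ‖(↑D⁻¹ : R) * F‖ ≤ 1 / 2)
    (hl1 : E * P + Ep * Rp = 1) (hl2 : Em * P + ((D : R) + F) * Rp = 0)
    (hr1 : P * E + Rm * Em = 1) (hr2 : P * Ep + Rm * ((D : R) + F) = 0) :
    ∃ u : Rˣ, (u : R) = P ∧ ‖(↑u⁻¹ : R)‖ ≤ A + 2 * A ^ 2 * ‖(↑D⁻¹ : R)‖ := by
  obtain ⟨w, hw, hwn⟩ := dominant_perturbation D F hF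
  rw [← hw] at hl2 hr2
  obtain ⟨u, hu, huinv⟩ := grushin_isUnit P Rm Rp E Ep Em w hl1 hl2 hr1 hr2
  refine ⟨u, hu, ?_⟩
  rw [huinv]
  refine (norm_schur_le E Ep Em _ A hA hE hEp hEm).trans ?_
  have : A ^ 2 * ‖(↑w⁻¹ : R)‖ ≤ A ^ 2 * (2 * ‖(↑D⁻¹ : R)‖) :=
    mul_le_mul_of_nonneg_left hwn (sq_nonneg A)
  linarith

end Norms

end Summit.AnomalousDissipation.AnomalousDissipation.Theorems
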